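import Summits.CriticalPhenomena.PercolationContinuityZ3.Theorems.PercNearOneGluingNoHeavyLowerTailFKCSHUnfoldMain
import Summits.CriticalPhenomena.PercolationContinuityZ3.Theorems.PercNearOneGluingNoHeavyLowerTailFKCSHToAdditiveGluing
import Summits.CriticalPhenomena.PercolationContinuityZ3.Theorems.PercNearOneGluingNoHeavyLowerTailFKCovTransferRelaySet
import Summits.CriticalPhenomena.PercolationContinuityZ3.Theorems.PercNearOneGluingNoHeavyLowerTailFKCoefficientMono
import HarnessLib

/-!
# FK sub-lane: LEMMA H for `φ_{w,q}` modulo the two-source diagonal (Htw)_FK, and the FK finite leg assembled on the two ATOMIC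
# located statements: `AdditiveGluingFK q ⟸ PhiFKMonotone q ∧ HtwFK q` (`q ≥ 1`)

Support / definitions file (`--supports stmt-CriticalPhenomena-4575`), FK sub-lane `prim-bschramm-fk-1` (gen 2) of the post-continuity
programme; builds on p205010 (kernel theorem, internal audit signed; external expert review pending).  No named facts, no sorries; standard
axioms.  Port of png-lead's `CSH.hpart_nonneg_of_htw` (`…AdditiveGluingCSHHpart.lean`, memo PROOF-S5-ALL-R.md §3.4) to the random-cluster
measure: (K6) in each world is fk-2's tree theorem `FK.covTransfer_relaySet_edge_rc` (p210469), world positivity is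
`FK.rcMeasureW_real_pos_of_empty_mem`; the only remaining input is the two-source diagonal (Htw) for `φ_{w,q}` — fk-2 gen 3's paper claim
(bschramm/FK-Q2.md §12.6(c), second Bernstein deformation, base (★^H)_FK), typed here as the statement `FK.HtwFK q` (NOT asserted).

* `FK.hpart_nonneg_of_htw_rc` — Lemma H_FK modulo (Htw)_FK, at a fixed vertex type (measure level);
* `FK.HtwFK q` — (Htw) for `φ_{w,q}` as a statement (the exact FK shape of prim-hp-4's `CSH.htw_world`); `FK.htwFK_one : HtwFK 1`;
* `FK.hpartFK_of_htwFK : 1 ≤ q → HtwFK q → HpartFK q`;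
* **`FK.cshFK_of_htwFK_of_phiFKMonotone`, `FK.additiveGluingFK_of_htwFK_of_phiFKMonotone : 1 ≤ q → PhiFKMonotone q → HtwFK q → AdditiveGluingFK q`**.
So the FK finite leg (`q ≥ 1`) hangs on exactly two atomic named statements: `FK.PhiFKMonotone q` (Lemma Φ(b)_FK, fk-1 gen 2) and
`FK.HtwFK q` ((Htw)_FK, fk-2).  Everything else is kernel-checked.
[cite: VandenbergHaggstromKahn2005, Thm. 1.4 (p. 7), §2.1 (pp. 9–13)] [cite: KozmaNitzan2024, Conj. 1 (p. 3), Conj. 4 (p. 32)]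
[cite: Grimmett2006, §1.4 eq. (1.20) (p. 15); Thm. (3.8)]
-/

noncomputable section

namespace Summit.CriticalPhenomena.PercolationContinuityZ3.Theorems

open MeasureTheory Set Literature.Probability.LatticeModels Literature.Probability.Percolation
open scoped Classical
open BHK2006 DecisionTree HullPort

namespace FK

variable {V : Type*} [Fintype V]

/-- **LEMMA H for `φ_{w,q}` modulo (Htw)** (png-lead's `CSH.hpart_nonneg_of_htw` for the random-cluster measure, `q ≥ 1`): non-degenerate
parameters, owner `x ∈ S`, observers `o`, `v ∉ S ∪ Y`, worlds `φ^ω = rcMeasureW (delW w A_Y(ω)) q ∅`, `g` monotone; `p = φ(o↔v | v ↮ S ∪ Y)`.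
CLAIM: `0 ≤ ∫_{x↮Y} [Cov_{φ^ω}(g(C_x),1{o↔S}) − p·Cov_{φ^ω}(g(C_x),1{v↔S})] dφ` GIVEN (Htw)_FK (hypothesis `hHtw`): (K6)_rc in each world
(`FK.covTransfer_relaySet_edge_rc` at the parameters `delW w A_Y(ω)`) and (Htw) trades the world constant for the global `p`.
[cite: VandenbergHaggstromKahn2005, Thm. 1.4 (p. 7)] -/
theorem hpart_nonneg_of_htw_rc (w : Sym2 V → unitInterval) {q : ℝ} (hq : 1 ≤ q) (hw : ∀ e, 0 < w e ∧ w e < 1) (x : V) (Y : Set V)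
    (S : Finset V) (hxS : x ∈ S) (o v : V) (hvS : v ∉ S) (hvY : v ∉ Y) (g : Set (Sym2 V) → ℝ) (hg : Monotone g)
    (hHtw : (rcMeasureW w q ∅).real ({ω : BondConfig V | ∀ a ∈ (↑S ∪ Y : Set V), ¬ (openGraph ω).Reachable v a} ∩ openConn o v) *
        (∫ ω in {ω : BondConfig V | ∀ y ∈ Y, ¬ (openGraph ω).Reachable x y},
          ((∫ η in (⋃ t ∈ S, openConn v t), g (openEdgeCluster η x)
              ∂(rcMeasureW (delW w {e | ∃ z ∈ e, ∃ y ∈ Y, (openGraph ω).Reachable y z}) q ∅)) -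
            (rcMeasureW (delW w {e | ∃ z ∈ e, ∃ y ∈ Y, (openGraph ω).Reachable y z}) q ∅).real (⋃ t ∈ S, openConn v t) *
              (∫ η, g (openEdgeCluster η x)
                ∂(rcMeasureW (delW w {e | ∃ z ∈ e, ∃ y ∈ Y, (openGraph ω).Reachable y z}) q ∅)))
          ∂(rcMeasureW w q ∅)) ≤
      (rcMeasureW w q ∅).real {ω : BondConfig V | ∀ a ∈ (↑S ∪ Y : Set V), ¬ (openGraph ω).Reachable v a} *
        (∫ ω in {ω : BondConfig V | ∀ y ∈ Y, ¬ (openGraph ω).Reachable x y},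
          ((rcMeasureW (delW w {e | ∃ z ∈ e, ∃ y ∈ Y, (openGraph ω).Reachable y z}) q ∅).real
                ({η : BondConfig V | ∀ t ∈ S, ¬ (openGraph η).Reachable v t} ∩ openConn o v) /
              (rcMeasureW (delW w {e | ∃ z ∈ e, ∃ y ∈ Y, (openGraph ω).Reachable y z}) q ∅).real
                {η : BondConfig V | ∀ t ∈ S, ¬ (openGraph η).Reachable v t}) *
          ((∫ η in (⋃ t ∈ S, openConn v t), g (openEdgeCluster η x)
              ∂(rcMeasureW (delW w {e | ∃ z ∈ e, ∃ y ∈ Y, (openGraph ω).Reachable y z}) q ∅)) -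
            (rcMeasureW (delW w {e | ∃ z ∈ e, ∃ y ∈ Y, (openGraph ω).Reachable y z}) q ∅).real (⋃ t ∈ S, openConn v t) *
              (∫ η, g (openEdgeCluster η x)
                ∂(rcMeasureW (delW w {e | ∃ z ∈ e, ∃ y ∈ Y, (openGraph ω).Reachable y z}) q ∅)))
          ∂(rcMeasureW w q ∅))) :
    0 ≤ ∫ ω in {ω : BondConfig V | ∀ y ∈ Y, ¬ (openGraph ω).Reachable x y},
      (((∫ η in (⋃ t ∈ S, openConn o t), g (openEdgeCluster η x)
            ∂(rcMeasureW (delW w {e | ∃ z ∈ e, ∃ y ∈ Y, (openGraph ω).Reachable y z}) q ∅)) -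
          (rcMeasureW (delW w {e | ∃ z ∈ e, ∃ y ∈ Y, (openGraph ω).Reachable y z}) q ∅).real (⋃ t ∈ S, openConn o t) *
            (∫ η, g (openEdgeCluster η x)
              ∂(rcMeasureW (delW w {e | ∃ z ∈ e, ∃ y ∈ Y, (openGraph ω).Reachable y z}) q ∅))) -
        obsConstμ (rcMeasureW w q ∅) o v (↑S ∪ Y) *
          ((∫ η in (⋃ t ∈ S, openConn v t), g (openEdgeCluster η x)
              ∂(rcMeasureW (delW w {e | ∃ z ∈ e, ∃ y ∈ Y, (openGraph ω).Reachable y z}) q ∅)) -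
            (rcMeasureW (delW w {e | ∃ z ∈ e, ∃ y ∈ Y, (openGraph ω).Reachable y z}) q ∅).real (⋃ t ∈ S, openConn v t) *
              (∫ η, g (openEdgeCluster η x)
                ∂(rcMeasureW (delW w {e | ∃ z ∈ e, ∃ y ∈ Y, (openGraph ω).Reachable y z}) q ∅))))
      ∂(rcMeasureW w q ∅) := by
  have hq0 : 0 < q := one_pos.trans_le hq
  haveI := isProbabilityMeasure_rcMeasureW w hq0 (∅ : Set V)
  set μ := rcMeasureW w q ∅ with hμ
  -- world parameters and world quantities
  set wW : BondConfig V → Sym2 V → unitInterval := fun ω => delW w {e | ∃ z ∈ e, ∃ y ∈ Y, (openGraph ω).Reachable y z} with hwW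
  set CovO : BondConfig V → ℝ := fun ω =>
    (∫ η in (⋃ t ∈ S, openConn o t), g (openEdgeCluster η x) ∂(rcMeasureW (wW ω) q ∅)) -
      (rcMeasureW (wW ω) q ∅).real (⋃ t ∈ S, openConn o t) * ∫ η, g (openEdgeCluster η x) ∂(rcMeasureW (wW ω) q ∅) with hCovO
  set CovV : BondConfig V → ℝ := fun ω =>
    (∫ η in (⋃ t ∈ S, openConn v t), g (openEdgeCluster η x) ∂(rcMeasureW (wW ω) q ∅)) -
      (rcMeasureW (wW ω) q ∅).real (⋃ t ∈ S, openConn v t) * ∫ η, g (openEdgeCluster η x) ∂(rcMeasureW (wW ω) q ∅) with hCovV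
  set pW : BondConfig V → ℝ := fun ω =>
    (rcMeasureW (wW ω) q ∅).real ({η : BondConfig V | ∀ t ∈ S, ¬ (openGraph η).Reachable v t} ∩ openConn o v) /
      (rcMeasureW (wW ω) q ∅).real {η : BondConfig V | ∀ t ∈ S, ¬ (openGraph η).Reachable v t} with hpW
  set M : ℝ := μ.real {ω : BondConfig V | ∀ a ∈ (↑S ∪ Y : Set V), ¬ (openGraph ω).Reachable v a} with hM
  set E : ℝ := μ.real ({ω : BondConfig V | ∀ a ∈ (↑S ∪ Y : Set V), ¬ (openGraph ω).Reachable v a} ∩ openConn o v) with hE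
  set Dset : Set (BondConfig V) := {ω : BondConfig V | ∀ y ∈ Y, ¬ (openGraph ω).Reachable x y} with hDset
  change E * ∫ ω in Dset, CovV ω ∂μ ≤ M * ∫ ω in Dset, pW ω * CovV ω ∂μ at hHtw
  change 0 ≤ ∫ ω in Dset, (CovO ω - obsConstμ μ o v (↑S ∪ Y) * CovV ω) ∂μ
  have hmeas : ∀ T : Set (BondConfig V), MeasurableSet T := fun _ => MeasurableSet.of_discrete
  have hint : ∀ (k : BondConfig V → ℝ) (T : Set (BondConfig V)), IntegrableOn k T μ :=
    fun k T => (Integrable.of_finite).integrableOn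
  -- positivity of the global conditioning probability and the observers' constant
  have hMpos : 0 < M := by
    refine rcMeasureW_real_pos_of_nonempty hq0 hw ∅ ⟨∅, fun a ha hreach => ?_⟩
    have hbot : openGraph (∅ : BondConfig V) = ⊥ := by
      unfold openGraph; exact SimpleGraph.fromEdgeSet_empty
    rw [hbot, SimpleGraph.reachable_bot] at hreach
    subst hreach
    rcases ha with ha | ha
    · exact hvS (Finset.mem_coe.1 ha)
    · exact hvY ha
  have hobs : obsConstμ μ o v (↑S ∪ Y) = E / M := by unfold obsConstμ; rfl
  -- (K6)_rc in each world: `pW ω · CovV ω ≤ CovO ω`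
  have hworld : ∀ ω : BondConfig V, pW ω * CovV ω ≤ CovO ω := by
    intro ω
    have hK6 := covTransfer_relaySet_edge_rc (wW ω) hq S o v x hxS g hg
    have hlt : ∀ e, ((wW ω e : unitInterval) : ℝ) < 1 := by
      intro e
      simp only [hwW, delW]
      split_ifs
      · exact zero_lt_one
      · exact (hw e).2
    have hMWpos : 0 < (rcMeasureW (wW ω) q ∅).real {η : BondConfig V | ∀ t ∈ S, ¬ (openGraph η).Reachable v t} := by
      refine rcMeasureW_real_pos_of_empty_mem (wW ω) hq0 hlt ∅ (fun t ht hreach => ?_)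
      have hbot : openGraph (∅ : BondConfig V) = ⊥ := by
        unfold openGraph; exact SimpleGraph.fromEdgeSet_empty
      rw [hbot, SimpleGraph.reachable_bot] at hreach
      exact hvS (hreach ▸ ht)
    set MW := (rcMeasureW (wW ω) q ∅).real {η : BondConfig V | ∀ t ∈ S, ¬ (openGraph η).Reachable v t} with hMW
    set EW := (rcMeasureW (wW ω) q ∅).real ({η : BondConfig V | ∀ t ∈ S, ¬ (openGraph η).Reachable v t} ∩ openConn o v) with hEW
    change EW * CovV ω ≤ MW * CovO ω at hK6
    have hp : pW ω = EW / MW := rfl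
    rw [hp, div_mul_eq_mul_div, div_le_iff₀ hMWpos]
    linarith [hK6, mul_comm MW (CovO ω)]
  have hI1 : ∫ ω in Dset, pW ω * CovV ω ∂μ ≤ ∫ ω in Dset, CovO ω ∂μ :=
    setIntegral_mono_on (hint _ _) (hint _ _) (hmeas Dset) fun ω _ => hworld ω
  have hI2 : E / M * ∫ ω in Dset, CovV ω ∂μ ≤ ∫ ω in Dset, pW ω * CovV ω ∂μ := by
    rw [div_mul_eq_mul_div, div_le_iff₀ hMpos]
    linarith [hHtw, mul_comm M (∫ ω in Dset, pW ω * CovV ω ∂μ)]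
  rw [integral_sub (hint _ _) (hint _ _), integral_const_mul, hobs]
  linarith [hI1, hI2]

/-- **(Htw) FOR THE RANDOM-CLUSTER MEASURE as a statement** (parametrised by `q`; NOT asserted): the two-source diagonal inequality of
prim-hp-4's `CSH.htw_world` with `φ_{w,q}` and the worlds `rcMeasureW (delW w A_Y(ω)) q ∅`:
`φ(v↮S∪Y, o↔v)·∫_{x↮Y} Cov_{φ^ω}(g,1{v↔S}) dφ ≤ φ(v↮S∪Y)·∫_{x↮Y} p_ω·Cov_{φ^ω}(g,1{v↔S}) dφ`, `p_ω = φ^ω(o↔v | v↮S)`, for non-degenerate `w`,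
`x ∈ S`, `v ∉ S`, monotone `g ≥ 0`.  `q = 1`: `FK.htwFK_one` (hp-4's A2^H induction; builds on p205010 (kernel theorem, internal audit signed;
external expert review pending)); `q > 1`: fk-2 gen 3's paper claim via the second Bernstein deformation and (★^H)_FK (bschramm/FK-Q2.md
§12.6(c)), Lean port pending — the row-K device (Ahlswede–Daykin star induction) does NOT transplant (fk-2's exact C₄ witness), so this is a
genuine target. (transcription of the cell memo prim-hp-8 PROOF-S5-ALL-R.md §2 (K9) diagonal, FK-parametrised)
[cite: VandenbergHaggstromKahn2005, Thm. 1.4 (p. 7), §2.1 (pp. 9–13)] -/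
def HtwFK (q : ℝ) : Prop :=
  ∀ (n : ℕ) (w : Sym2 (Fin n) → unitInterval), (∀ e, 0 < w e ∧ w e < 1) →
    ∀ (x : Fin n) (Y : Set (Fin n)) (S : Finset (Fin n)), x ∈ S → ∀ (o v : Fin n), v ∉ S →
    ∀ g : Set (Sym2 (Fin n)) → ℝ, Monotone g → (∀ C, 0 ≤ g C) →
    (rcMeasureW w q ∅).real ({ω : BondConfig (Fin n) | ∀ a ∈ (↑S ∪ Y : Set (Fin n)), ¬ (openGraph ω).Reachable v a} ∩ openConn o v) *
        (∫ ω in {ω : BondConfig (Fin n) | ∀ y ∈ Y, ¬ (openGraph ω).Reachable x y},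
          ((∫ η in (⋃ t ∈ S, openConn v t), g (openEdgeCluster η x)
              ∂(rcMeasureW (delW w {e | ∃ z ∈ e, ∃ y ∈ Y, (openGraph ω).Reachable y z}) q ∅)) -
            (rcMeasureW (delW w {e | ∃ z ∈ e, ∃ y ∈ Y, (openGraph ω).Reachable y z}) q ∅).real (⋃ t ∈ S, openConn v t) *
              (∫ η, g (openEdgeCluster η x)
                ∂(rcMeasureW (delW w {e | ∃ z ∈ e, ∃ y ∈ Y, (openGraph ω).Reachable y z}) q ∅)))
          ∂(rcMeasureW w q ∅)) ≤
      (rcMeasureW w q ∅).real {ω : BondConfig (Fin n) | ∀ a ∈ (↑S ∪ Y : Set (Fin n)), ¬ (openGraph ω).Reachable v a} *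
        (∫ ω in {ω : BondConfig (Fin n) | ∀ y ∈ Y, ¬ (openGraph ω).Reachable x y},
          ((rcMeasureW (delW w {e | ∃ z ∈ e, ∃ y ∈ Y, (openGraph ω).Reachable y z}) q ∅).real
                ({η : BondConfig (Fin n) | ∀ t ∈ S, ¬ (openGraph η).Reachable v t} ∩ openConn o v) /
              (rcMeasureW (delW w {e | ∃ z ∈ e, ∃ y ∈ Y, (openGraph ω).Reachable y z}) q ∅).real
                {η : BondConfig (Fin n) | ∀ t ∈ S, ¬ (openGraph η).Reachable v t}) *
          ((∫ η in (⋃ t ∈ S, openConn v t), g (openEdgeCluster η x)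
              ∂(rcMeasureW (delW w {e | ∃ z ∈ e, ∃ y ∈ Y, (openGraph ω).Reachable y z}) q ∅)) -
            (rcMeasureW (delW w {e | ∃ z ∈ e, ∃ y ∈ Y, (openGraph ω).Reachable y z}) q ∅).real (⋃ t ∈ S, openConn v t) *
              (∫ η, g (openEdgeCluster η x)
                ∂(rcMeasureW (delW w {e | ∃ z ∈ e, ∃ y ∈ Y, (openGraph ω).Reachable y z}) q ∅)))
          ∂(rcMeasureW w q ∅))

/-- **`q = 1`: (Htw) holds** — `FK.HtwFK 1` is prim-hp-4's `CSH.htw_world` (A2^H induction for product measure; builds on p205010 (kernel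
theorem, internal audit signed; external expert review pending)). [cite: VandenbergHaggstromKahn2005, Thm. 1.4 (p. 7)] -/
theorem htwFK_one : HtwFK 1 := by
  intro n w _hw x Y S hxS o v hvS g hg hg0
  have key := CSH.htw_world w x Y S hxS o v hvS g hg hg0
  have e : ∀ ω : BondConfig (Fin n), delW w {e : Sym2 (Fin n) | ∃ z ∈ e, ∃ y ∈ Y, (openGraph ω).Reachable y z} =
      fun e => if (∃ z ∈ e, ∃ y ∈ Y, (openGraph ω).Reachable y z) then (0 : unitInterval) else w e := by
    intro ω; funext e'
    by_cases h : ∃ z ∈ e', ∃ y ∈ Y, (openGraph ω).Reachable y z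
    · rw [if_pos h]; simp only [delW, Set.mem_setOf_eq, if_pos h]
    · rw [if_neg h]; simp only [delW, Set.mem_setOf_eq, if_neg h]
  simp only [rcMeasureW_one, e]
  -- the two statements agree up to the (subsingleton) decidability instances inside the world weights
  convert key using 20

/-- **Lemma H_FK from (Htw)_FK** (`q ≥ 1`): `FK.HtwFK q → FK.HpartFK q`. [cite: VandenbergHaggstromKahn2005, Thm. 1.4 (p. 7)] -/
theorem hpartFK_of_htwFK {q : ℝ} (hq : 1 ≤ q) (hT : HtwFK q) : HpartFK q :=
  fun n w hw x Y S hxS o v hvS hvY g hg hg0 =>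
    hpart_nonneg_of_htw_rc w hq hw x Y S hxS o v hvS hvY g hg (hT n w hw x Y S hxS o v hvS g hg hg0)

/-- **The FK hierarchy from the two ATOMIC located statements**: `1 ≤ q → PhiFKMonotone q → HtwFK q → CSHFK q`.
[cite: VandenbergHaggstromKahn2005, §2.1 (pp. 9–13)] [cite: KozmaNitzan2024, Conj. 4 (p. 32)] -/
theorem cshFK_of_htwFK_of_phiFKMonotone {q : ℝ} (hq : 1 ≤ q) (hΦ : PhiFKMonotone q) (hT : HtwFK q) : CSHFK q :=
  cshFK_of_hpartFK_of_phiFKMonotone hq hΦ (hpartFK_of_htwFK hq hT)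

/-- **FK ADDITIVE GLUING FROM THE TWO ATOMIC LOCATED STATEMENTS**: `1 ≤ q → PhiFKMonotone q → HtwFK q → AdditiveGluingFK q` —
Kozma–Nitzan's additive gluing for every random-cluster measure `φ_{w,q}` on every finite weighted graph, reduced in Lean to Lemma Φ(b)_FK
and (Htw)_FK.  NOTHING is asserted about the two hypotheses for `q ≠ 1`. [cite: KozmaNitzan2024, Conj. 1 (p. 3)] -/
theorem additiveGluingFK_of_htwFK_of_phiFKMonotone {q : ℝ} (hq : 1 ≤ q) (hΦ : PhiFKMonotone q) (hT : HtwFK q) :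
    AdditiveGluingFK q :=
  additiveGluingFK_of_cshFK hq (cshFK_of_htwFK_of_phiFKMonotone hq hΦ hT)

/-- `q = 1` regression through the atomic form: `AdditiveGluingFK 1` from `FK.phiFKMonotone_one` and `FK.htwFK_one`.
[cite: KozmaNitzan2024, Conj. 1 (p. 3)] -/
example : AdditiveGluingFK 1 := additiveGluingFK_of_htwFK_of_phiFKMonotone le_rfl phiFKMonotone_one htwFK_one

end FK

end Summit.CriticalPhenomena.PercolationContinuityZ3.Theorems

end
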